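import Mathlib.MeasureTheory.Integral.IntegralEqImproper
import Mathlib.Analysis.Calculus.BumpFunction.Basic
import Mathlib.Analysis.Calculus.BumpFunction.FiniteDimension
import Mathlib.Analysis.Calculus.Deriv.Support
import Mathlib.Analysis.Calculus.ContDiff.Deriv
import Mathlib.Analysis.Real.Pi.Bounds
import Literature.NumberTheory.LFunctions.WeilExplicit
import HarnessLib

/-!
# The Weil transform of test functions: linearity, translation, decay, non-vanishing

Sibling of `Literature/NumberTheory/LFunctions/WeilExplicit.lean` (same normalisation
`ĝ(s) = weilMellin g s = ∫ g(t) e^{(s - 1/2)t} dt`, test functions `IsWeilTest g`: smooth of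
compact support). Elementary analysis of the transform needed by the converse half of Weil's
criterion (`WeilCriterionProofs.lean`, steps D2/D5 of the discharge of
`weil_criterion_zeroSide_converse`; E. Bombieri, Rend. Lincei (9) 11 (2000), §3, where these
facts are used silently):

* linearity `(g + h)^ = ĝ + ĥ`, `(c g)^ = c ĝ` (`weilMellin_add`, `weilMellin_const_mul`) and the
  vector-space closure of `IsWeilTest`;
* translation `h_x(t) = h(t - x)` (`weilTranslate`) with `(h_x)^(s) = e^{(s-1/2)x} ĥ(s)`
  (`weilMellin_weilTranslate`);
* integration by parts `(g')^(s) = -(s - 1/2) ĝ(s)` (`weilMellin_deriv`, from Mathlib's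
  `integral_mul_deriv_eq_deriv_mul_of_integrable`) and the resulting decay in the closed critical
  strip, `‖ĝ(s)‖ ≤ C_g/(1 + (Im s)²)` for `0 ≤ Re s ≤ 1` (`norm_weilMellin_le`, with the explicit
  constant `weilDecayConst g = ∫ (‖g‖ + ‖g''‖) e^{|t|/2}`);
* for every ordinate `γ` a test function (a narrow bump, Mathlib's `ContDiffBump`) with
  `Re ĝ(σ + iγ) > 0` for all real `σ` (`exists_isWeilTest_re_weilMellin_pos`): on the support
  `|t| ≤ 1/(1 + |γ|)` the integrand `b(t) e^{(σ-1/2)t} cos(γt)` is `≥ 0` and positive at `0`.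

All statements are proved; no named facts. Mathlib has the tools (`ContDiffBump`,
`integral_mul_deriv_eq_deriv_mul_of_integrable`, `integral_sub_right_eq_self`) but not these
statements about `weilMellin` (an H21 definition).

## References

* E. Bombieri, *Remarks on Weil's quadratic functional in the theory of prime numbers I*, Atti
  Accad. Naz. Lincei Rend. Lincei (9) Mat. Appl. 11 (2000), 183–233, §§2–3.
-/

noncomputable section

open Complex Filter Set MeasureTheory
open scoped Real Topology ComplexConjugate ContDiff

namespace Literature.NumberTheory.LFunctions

variable {g h : ℝ → ℂ}

/-! ## Integrability of the Weil integrand -/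

/-- For continuous compactly supported `g`, the integrand `g(t) e^{(s-1/2)t}` of `ĝ(s)` is
integrable. [folklore] -/
theorem integrable_weilIntegrand (hg : Continuous g) (hg' : HasCompactSupport g) (s : ℂ) :
    Integrable fun t : ℝ ↦ g t * cexp ((s - 1 / 2) * t) :=
  (hg.mul (by fun_prop)).integrable_of_hasCompactSupport hg'.mul_right

/-! ## Linearity -/

/-- Additivity `(g + h)^ = ĝ + ĥ` for continuous compactly supported `g, h`. [folklore] -/
theorem weilMellin_add (hg : Continuous g) (hg' : HasCompactSupport g) (hh : Continuous h)
    (hh' : HasCompactSupport h) (s : ℂ) :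
    weilMellin (g + h) s = weilMellin g s + weilMellin h s := by
  unfold weilMellin
  rw [← integral_add (integrable_weilIntegrand hg hg' s) (integrable_weilIntegrand hh hh' s)]
  congr 1 with t
  simp only [Pi.add_apply]
  ring

/-- Homogeneity `(c g)^ = c ĝ` (no hypotheses). [folklore] -/
theorem weilMellin_const_mul (c : ℂ) (g : ℝ → ℂ) (s : ℂ) :
    weilMellin (fun t ↦ c * g t) s = c * weilMellin g s := by
  unfold weilMellin
  rw [← integral_const_mul]
  congr 1 with t
  ring

/-- Test functions form a vector space: sums. [folklore] -/
theorem IsWeilTest.add (hg : IsWeilTest g) (hh : IsWeilTest h) : IsWeilTest (g + h) :=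
  ⟨hg.1.add hh.1, hg.2.add hh.2⟩

/-- Test functions form a vector space: scalar multiples. [folklore] -/
theorem IsWeilTest.const_mul (hg : IsWeilTest g) (c : ℂ) : IsWeilTest fun t ↦ c * g t :=
  ⟨contDiff_const.mul hg.1, hg.2.mul_left⟩

/-! ## Translation -/

/-- The translate `h_x(t) = h(t - x)`. [folklore] -/
def weilTranslate (h : ℝ → ℂ) (x : ℝ) : ℝ → ℂ :=
  fun t ↦ h (t - x)

/-- Translates of test functions are test functions. [folklore] -/
theorem IsWeilTest.weilTranslate (hh : IsWeilTest h) (x : ℝ) :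
    IsWeilTest (weilTranslate h x) := by
  refine ⟨hh.1.comp (contDiff_id.sub contDiff_const), ?_⟩
  have e : Literature.NumberTheory.LFunctions.weilTranslate h x = h ∘ (Homeomorph.addRight (-x)) := by
    ext t
    simp [Literature.NumberTheory.LFunctions.weilTranslate, sub_eq_add_neg]
  rw [e]
  exact hh.2.comp_homeomorph _

/-- Transform of a translate: `(h_x)^(s) = e^{(s-1/2)x} ĥ(s)` (substitute `t ↦ t + x`; no
hypotheses). [folklore] -/
theorem weilMellin_weilTranslate (h : ℝ → ℂ) (x : ℝ) (s : ℂ) :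
    weilMellin (weilTranslate h x) s = cexp ((s - 1 / 2) * x) * weilMellin h s := by
  unfold weilMellin weilTranslate
  rw [← integral_const_mul]
  have key := integral_sub_right_eq_self (μ := (volume : Measure ℝ))
    (fun u : ℝ ↦ cexp ((s - 1 / 2) * x) * (h u * cexp ((s - 1 / 2) * u))) x
  rw [← key]
  congr 1 with t
  rw [← mul_assoc, mul_comm (cexp _) (h _), mul_assoc, ← Complex.exp_add]
  congr 2
  push_cast
  ring

/-! ## Integration by parts and decay in the critical strip -/

/-- Derivatives of test functions are test functions. [folklore] -/
theorem IsWeilTest.deriv (hg : IsWeilTest g) : IsWeilTest (deriv g) :=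
  ⟨hg.1.deriv', hg.2.deriv⟩

/-- Integration by parts: `(g')^(s) = -(s - 1/2) ĝ(s)` for a test function `g` (the boundary
terms vanish by compact support; `integral_mul_deriv_eq_deriv_mul_of_integrable`). [folklore] -/
theorem weilMellin_deriv (hg : IsWeilTest g) (s : ℂ) :
    weilMellin (deriv g) s = -(s - 1 / 2) * weilMellin g s := by
  unfold weilMellin
  have hd : IsWeilTest (deriv g) := hg.deriv
  set w : ℂ := s - 1 / 2 with hw
  -- `u = e^{wt}`, `v = g`
  have hu : ∀ t : ℝ, HasDerivAt (fun t : ℝ ↦ cexp (w * t)) (w * cexp (w * t)) t := by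
    intro t
    have h1 : HasDerivAt (fun t : ℝ ↦ w * (t : ℂ)) (w * 1) t :=
      (Complex.ofRealCLM.hasDerivAt.const_mul w).congr_deriv (by simp)
    have h2 := (Complex.hasDerivAt_exp (w * t)).comp t h1
    simpa [mul_comm, Function.comp_def] using h2
  have hv : ∀ t : ℝ, HasDerivAt g (deriv g t) t := fun t ↦
    (hg.1.differentiable (by simp) t).hasDerivAt
  have key := integral_mul_deriv_eq_deriv_mul_of_integrable (u := fun t : ℝ ↦ cexp (w * t))
    (u' := fun t : ℝ ↦ w * cexp (w * t)) (v := g) (v' := deriv g)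
    (fun t _ ↦ hu t) (fun t _ ↦ hv t) ?_ ?_ ?_
  · calc ∫ t : ℝ, deriv g t * cexp (w * t) = ∫ t : ℝ, cexp (w * t) * deriv g t := by
          congr 1 with t; ring
      _ = -∫ t : ℝ, w * cexp (w * t) * g t := key
      _ = -w * ∫ t : ℝ, g t * cexp (w * t) := by
          rw [neg_mul, ← integral_const_mul]
          congr 2 with t; ring
  · have := integrable_weilIntegrand hd.1.continuous hd.2 s
    rw [← hw] at this
    exact this.congr (Eventually.of_forall fun t ↦ by simp [mul_comm])
  · have := (integrable_weilIntegrand hg.1.continuous hg.2 s).const_mul w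
    rw [← hw] at this
    exact this.congr (Eventually.of_forall fun t ↦ by simp [Pi.mul_apply]; ring)
  · have := integrable_weilIntegrand hg.1.continuous hg.2 s
    rw [← hw] at this
    exact this.congr (Eventually.of_forall fun t ↦ by simp [mul_comm])

/-- Twice: `(g'')^(s) = (s - 1/2)² ĝ(s)`. [folklore] -/
theorem weilMellin_deriv_deriv (hg : IsWeilTest g) (s : ℂ) :
    weilMellin (deriv (deriv g)) s = (s - 1 / 2) ^ 2 * weilMellin g s := by
  rw [weilMellin_deriv hg.deriv, weilMellin_deriv hg]
  ring

/-- The weighted `L¹`-norm `∫ ‖g(t)‖ e^{|t|/2} dt` controlling `ĝ` in the closed critical strip. [folklore] -/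
def weilL1 (g : ℝ → ℂ) : ℝ :=
  ∫ t : ℝ, ‖g t‖ * Real.exp (|t| / 2)

/-- `weilL1 g ≥ 0`. [folklore] -/
theorem weilL1_nonneg (g : ℝ → ℂ) : 0 ≤ weilL1 g :=
  integral_nonneg fun _ ↦ by positivity

/-- In the closed strip `0 ≤ Re s ≤ 1`: `‖ĝ(s)‖ ≤ ∫ ‖g‖ e^{|t|/2}` for continuous compactly
supported `g`. [folklore] -/
theorem norm_weilMellin_le_weilL1 (hg : Continuous g) (hg' : HasCompactSupport g) {s : ℂ}
    (hs0 : 0 ≤ s.re) (hs1 : s.re ≤ 1) : ‖weilMellin g s‖ ≤ weilL1 g := by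
  unfold weilMellin weilL1
  refine (norm_integral_le_integral_norm _).trans (integral_mono_of_nonneg
    (Eventually.of_forall fun _ ↦ norm_nonneg _) ?_ (Eventually.of_forall fun t ↦ ?_))
  · exact ((hg.norm.mul (by fun_prop)).integrable_of_hasCompactSupport hg'.norm.mul_right)
  · simp only [norm_mul, Complex.norm_exp]
    refine mul_le_mul_of_nonneg_left (Real.exp_le_exp.2 ?_) (norm_nonneg _)
    have hre : ((s - 1 / 2) * (t : ℂ)).re = (s.re - 1 / 2) * t := by
      simp [sub_re, mul_re]
    rw [hre]
    have h1 : |s.re - 1 / 2| ≤ 1 / 2 := abs_le.2 ⟨by linarith, by linarith⟩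
    calc (s.re - 1 / 2) * t ≤ |(s.re - 1 / 2) * t| := le_abs_self _
      _ = |s.re - 1 / 2| * |t| := abs_mul _ _
      _ ≤ 1 / 2 * |t| := mul_le_mul_of_nonneg_right h1 (abs_nonneg _)
      _ = |t| / 2 := by ring

/-- The decay constant `C_g = ∫ ‖g‖ e^{|t|/2} + ∫ ‖g''‖ e^{|t|/2}`. [folklore] -/
def weilDecayConst (g : ℝ → ℂ) : ℝ :=
  weilL1 g + weilL1 (deriv (deriv g))

/-- `C_g ≥ 0`. [folklore] -/
theorem weilDecayConst_nonneg (g : ℝ → ℂ) : 0 ≤ weilDecayConst g :=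
  add_nonneg (weilL1_nonneg _) (weilL1_nonneg _)

/-- **Decay of `ĝ` in the critical strip**: for a test function `g` and `0 ≤ Re s ≤ 1`,
`‖ĝ(s)‖ ≤ C_g / (1 + (Im s)²)` (two integrations by parts). [folklore] -/
theorem norm_weilMellin_le (hg : IsWeilTest g) {s : ℂ} (hs0 : 0 ≤ s.re) (hs1 : s.re ≤ 1) :
    ‖weilMellin g s‖ ≤ weilDecayConst g / (1 + s.im ^ 2) := by
  have hpos : 0 < 1 + s.im ^ 2 := by positivity
  rw [le_div_iff₀ hpos]
  have h1 : ‖weilMellin g s‖ ≤ weilL1 g := norm_weilMellin_le_weilL1 hg.1.continuous hg.2 hs0 hs1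
  have h2 : ‖weilMellin (deriv (deriv g)) s‖ ≤ weilL1 (deriv (deriv g)) :=
    norm_weilMellin_le_weilL1 hg.deriv.deriv.1.continuous hg.deriv.deriv.2 hs0 hs1
  rw [weilMellin_deriv_deriv hg, norm_mul, norm_pow] at h2
  have h3 : s.im ^ 2 ≤ ‖s - 1 / 2‖ ^ 2 := by
    have : |s.im| ≤ ‖s - 1 / 2‖ := by
      have h := Complex.abs_im_le_norm (s - 1 / 2)
      simpa using h
    nlinarith [abs_nonneg s.im, sq_abs s.im]
  unfold weilDecayConst
  have h4 : 0 ≤ ‖weilMellin g s‖ := norm_nonneg _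
  nlinarith

/-! ## A test function whose transform does not vanish on a given horizontal line -/

/-- For every ordinate `γ` there is a test function `g` (a narrow non-negative bump at `0`) with
`Re ĝ(σ + iγ) > 0` for every real `σ`: on the support `|t| < 1/(1 + |γ|)` one has
`cos(γ t) > 0`. [folklore] -/
theorem exists_isWeilTest_re_weilMellin_pos (γ : ℝ) :
    ∃ g : ℝ → ℂ, IsWeilTest g ∧ ∀ σ : ℝ, 0 < (weilMellin g (σ + γ * I)).re := by
  set δ : ℝ := 1 / (1 + |γ|) with hδ
  have hδpos : 0 < δ := by positivity
  let b : ContDiffBump (0 : ℝ) := ⟨δ / 2, δ, by positivity, by linarith⟩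
  refine ⟨fun t ↦ ((b t : ℝ) : ℂ), ⟨?_, ?_⟩, fun σ ↦ ?_⟩
  · exact Complex.ofRealCLM.contDiff.comp b.contDiff
  · exact b.hasCompactSupport.comp_left Complex.ofReal_zero
  · -- the integrand has real part `b(t) e^{(σ-1/2)t} cos(γ t) ≥ 0`, positive at `t = 0`
    set F : ℝ → ℝ := fun t ↦ b t * Real.exp ((σ - 1 / 2) * t) * Real.cos (γ * t) with hF
    have hint : Integrable fun t : ℝ ↦ ((b t : ℝ) : ℂ) * cexp ((σ + γ * I - 1 / 2) * t) :=
      integrable_weilIntegrand (Complex.continuous_ofReal.comp b.continuous)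
        (b.hasCompactSupport.comp_left Complex.ofReal_zero) _
    have hre : ∀ t : ℝ, (((b t : ℝ) : ℂ) * cexp ((σ + γ * I - 1 / 2) * t)).re = F t := by
      intro t
      rw [Complex.re_ofReal_mul, Complex.exp_re]
      have h1 : ((σ + γ * I - 1 / 2) * (t : ℂ)).re = (σ - 1 / 2) * t := by
        simp [sub_re, add_re, mul_re]
      have h2 : ((σ + γ * I - 1 / 2) * (t : ℂ)).im = γ * t := by
        simp [sub_im, add_im, mul_im]
      rw [h1, h2, hF]
      ring
    unfold weilMellin
    have hI := integral_re hint
    simp only [RCLike.re_to_complex] at hI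
    beta_reduce
    rw [← hI]
    simp_rw [hre]
    have hFc : Continuous F := by
      simp only [hF]
      have hb := b.continuous
      fun_prop
    have hFsupp : HasCompactSupport F := by
      simp only [hF]
      exact (b.hasCompactSupport.mul_right).mul_right
    have hFnn : 0 ≤ F := by
      intro t
      simp only [hF, Pi.zero_apply]
      by_cases ht : |t| < δ
      · refine mul_nonneg (mul_nonneg (b.nonneg' t) (Real.exp_pos _).le) (Real.cos_nonneg_of_mem_Icc ?_)
        have hγt : |γ * t| ≤ 1 := by
          rw [abs_mul]
          calc |γ| * |t| ≤ |γ| * δ := mul_le_mul_of_nonneg_left ht.le (abs_nonneg _)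
            _ = |γ| / (1 + |γ|) := by rw [hδ]; ring
            _ ≤ 1 := by rw [div_le_one (by positivity)]; linarith
        constructor <;> nlinarith [abs_le.1 hγt, Real.pi_gt_three]
      · have hb : b t = 0 := b.zero_of_le_dist (by simpa [Real.dist_eq] using not_lt.1 ht)
        simp [hb]
    have hF0 : F 0 ≠ 0 := by
      have hb0 : b 0 = 1 := b.one_of_mem_closedBall (by simp [b]; positivity)
      simp [hF, hb0]
    exact hFc.integral_pos_of_hasCompactSupport_nonneg_nonzero hFsupp hFnn hF0

end Literature.NumberTheory.LFunctions

end
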